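import Summits.FinalStateConjecture.FinalStateConjecture.Theorems.EIHFluxBalanceInertialRecessionStubIdentificationWindow

/-!
# Route EIHFluxBalance — `InertialRecession`, line `sublinear-is-free-clean-window-charges`:
# the IDENTIFICATION of the clean-window charges (stub `stub_identification`, assembly)

Helper file (`--supports stmt-FinalStateConjecture-10166`) for the crux
`Summit.FinalStateConjecture.FinalStateConjecture.Theses.EIHFluxBalance.InertialRecession`.

`identification`: the statement of the stub `stub_identification` of the line — granted the
pseudotensor bound, under the crux antecedent with `0 < N`, slaving and quasi-stationarity, the
Landau–Lifshitz four-momentum of the lab metric through a `δ`-clean window sphere at a late time `t`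
equals `Σ_{holes inside} Mγ(1, v)` up to `ζ(t) → 0`. Assembly of the parts: the perforated Gauss law
(`LLGauss.perforatedGauss`) with small spheres of radius `ρ₀(t) → ∞` (slowly) about the holes inside the
window; the bulk is `O(N ρ₀^{-1/2})` by the pseudotensor bound and the far-field decay of the lab metric
(`ChargeModel.sphereConditions`, `abs_setIntegral_le_of_decay`); each small-sphere charge is within `o(1)`
of the charge of the frozen boosted Kerr field of its hole (`abs_quasiLocalMomentum_lab_sub_frozen_le`, with
the rotation-blind defect `opNorm_defect_le_of_rates` and the slaving rates), which is exactly `Mγ(1, v)`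
(`quasiLocalMomentum_boostedKerr_energy/_momentum`). [cite: LandauLifshitz1975, §96 (96.16)–(96.17)]
-/

set_option linter.dupNamespace false
-- instance search on the nested operator spaces needs a deeper pending depth (as in `CoordCurvature.lean`)
set_option maxSynthPendingDepth 3

noncomputable section

open scoped Manifold ContDiff Topology BigOperators ENNReal
open Filter Set Function TopologicalSpace MeasureTheory Metric Literature.Geometry.Lorentzian
open Literature.Geometry.Lorentzian.LandauLifshitz

namespace Summit.FinalStateConjecture.FinalStateConjecture.Theorems

namespace SublinearIsFree.ChargeModel

open SublinearIsFree.PseudotensorBound SublinearIsFree.QuasiStationarity LLBalance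

-- the algebraic and the operator-norm instance paths on `E4 →L[ℝ] E4 →L[ℝ] ℝ` unify slowly
set_option synthInstance.maxHeartbeats 400000 in
set_option maxHeartbeats 6400000 in
/-- **IDENTIFICATION of the clean-window charges** (see the module docstring).
[cite: LandauLifshitz1975, §96 (96.16)–(96.17)] -/
theorem cleanWindowCharges_identification : (∃ C : ℝ, 0 ≤ C ∧ ∀ (g : E4 → E4 →L[ℝ] E4 →L[ℝ] ℝ) (x : E4) (b : ℝ), ContDiffAt ℝ 2 g x → (∀ᶠ y in 𝓝 x, ∀ v w : E4, g y v w = g y w v) → ‖g x - Minkowski.bilin‖ ≤ 1 / 2 → (∀ v : E4, ‖fderiv ℝ g x v‖ ≤ b * ‖v‖) → ∀ μ ν : Fin 4, |LandauLifshitz.metricDet g x * LandauLifshitz.pseudotensor g x μ ν| ≤ C * b ^ 2) → ∀ (X : Type) [TopologicalSpace X] [ChartedSpace E3 X] [IsManifold (𝓡 3) ((⊤ : ℕ∞) : WithTop ℕ∞) X] [T2Space X] [SecondCountableTopology X] [ConnectedSpace X], ∀ D ∈ admissibleVacuumData X, ∀ 𝒟 : VacuumCauchyDevelopment D, 𝒟.IsMaximal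 → ∀ (N : ℕ) (M a rin : Fin N → ℝ) (Λ : Fin N → ℝ → lorentzGroup) (ξ : Fin N → ℝ → E3) (γ κ τ₀ : ℝ) (U : Opens E4) (Φ : U → 𝒟.carrier) (O : Set 𝒟.carrier), ((∀ i, Kerr.IsSubextremal (M i) (a i) ∧ Kerr.rMinus (M i) (a i) < rin i ∧ rin i < Kerr.rPlus (M i) (a i)) ∧ (∀ i t, |((Λ i t : E4 ≃L[ℝ] E4) (E4.basisVector 0)) 0| ≤ γ) ∧ (∀ i, ContDiff ℝ ((⊤ : ℕ∞) : WithTop ℕ∞) (ξ i) ∧ ContDiff ℝ ((⊤ : ℕ∞) : WithTop ℕ∞) (fun t ↦ ((Λ i t : E4 ≃L[ℝ] E4) : E4 →L[ℝ] E4))) ∧ (∀ i j, i ≠ j → Tendsto (fun t ↦ ‖ξ i t - ξ j t‖) atTop atTop) ∧ (0 < κ ∧ κ < 1 ∧ ∀ i, ∀ᶠ t in atTop, ‖ξ i t‖ ≤ κ ^ 2 * t) ∧ ({x : E4 | τ₀ < x 0 ∧ ∀ i, rin i < Kerr.radius (a i) (poincareInv (Λ i (x 0)) (E4.ofTimeSpace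 (x 0) (ξ i (x 0))) x)} ⊆ (U : Set E4)) ∧ let B : ModelBackground := ⟨U, fun x ↦ Minkowski.bilin + ∑ i, (boostedKerrBilin (Λ i (x 0)) (E4.ofTimeSpace (x 0) (ξ i (x 0))) (M i) (a i) x - Minkowski.bilin), fun x ↦ x 0, E4.spatialNorm⟩; ContMDiff 𝓘(ℝ, E4) (𝓡 4) ((⊤ : ℕ∞) : WithTop ℕ∞) Φ ∧ Topology.IsOpenEmbedding ((B.lateRegion τ₀).restrict Φ) ∧ Φ '' {x : U | τ₀ < x.1 0 ∧ ∀ i, Kerr.rPlus (M i) (a i) < Kerr.radius (a i) (poincareInv (Λ i (x.1 0)) (E4.ofTimeSpace (x.1 0) (ξ i (x.1 0))) x.1)} ⊆ O ∧ Tendsto (fun t ↦ 𝒟.toSpacetime.deviationCk B Φ 3 t) atTop (𝓝 0) ∧ Tendsto (fun t : ℝ ↦ ⨆ x ∈ {x : U | x.1 0 = t ∧ E4.spatialNorm x.1 ≤ κ * t}, ⨆ (m : ℕ) (_ : m ≤ 3), ENNReal.ofReal (1 + √(√((⨅ i, ‖E4.spatial x.1 - ξ i t‖) ^ 7))) * ‖iteratedFDeriv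 ℝ m (𝒟.toSpacetime.deviationExtend B Φ) x.1‖ₑ) atTop (𝓝 0) ∧ O = Summit.FinalStateConjecture.exteriorOf 𝒟.toCauchyDevelopment (Φ '' {x : U | τ₀ < x.1 0 ∧ ∀ i, Kerr.rPlus (M i) (a i) < Kerr.radius (a i) (poincareInv (Λ i (x.1 0)) (E4.ofTimeSpace (x.1 0) (ξ i (x.1 0))) x.1)}) ∧ ∀ t₁ : ℝ, τ₀ < t₁ → O \ Φ '' {x : U | t₁ < x.1 0 ∧ ∀ i, Kerr.rPlus (M i) (a i) < Kerr.radius (a i) (poincareInv (Λ i (x.1 0)) (E4.ofTimeSpace (x.1 0) (ξ i (x.1 0))) x.1)} ⊆ 𝒟.metric.causalPast 𝒟.timeOrientation (Φ '' {x : U | x.1 0 = t₁ ∧ ∀ i, Kerr.rPlus (M i) (a i) < Kerr.radius (a i) (poincareInv (Λ i (x.1 0)) (E4.ofTimeSpace (x.1 0) (ξ i (x.1 0))) x.1)})) → 0 < N → (∀ i : Fin N, (∀ m : ℕ, 1 ≤ m → m ≤ 3 → Tendsto (fun t ↦ iteratedDeriv m (fun s ↦ (((Λ i s : lorentzGroup)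 : E4 ≃L[ℝ] E4) (E4.basisVector 0))) t) atTop (𝓝 0)) ∧ (∀ m : ℕ, m ≤ 2 → Tendsto (fun t ↦ iteratedDeriv m (fun s ↦ deriv (ξ i) s - (((((Λ i s : lorentzGroup) : E4 ≃L[ℝ] E4) (E4.basisVector 0)) 0)⁻¹ • E4.spatial (((Λ i s : lorentzGroup) : E4 ≃L[ℝ] E4) (E4.basisVector 0)))) t) atTop (𝓝 0)) ∧ (a i ≠ 0 → ∀ m : ℕ, 1 ≤ m → m ≤ 3 → Tendsto (fun t ↦ iteratedDeriv m (fun s ↦ (((Λ i s : lorentzGroup) : E4 ≃L[ℝ] E4) (E4.basisVector 3))) t) atTop (𝓝 0))) → (∀ ρ : ℝ → ℝ, Tendsto ρ atTop atTop → Tendsto (fun t : ℝ ↦ ⨆ x ∈ {x : E4 | x 0 = t ∧ E4.spatialNorm x ≤ κ * t ∧ ρ t ≤ ⨅ i, ‖E4.spatial x - ξ i t‖}, ENNReal.ofReal (1 + √(√((⨅ i, ‖E4.spatial x - ξ i t‖) ^ 7))) * ‖fderiv ℝ (fun y : E4 ↦ Minkowski.bilin + ∑ i, (boostedKerrBilin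 (Λ i (y 0)) (E4.ofTimeSpace (y 0) (ξ i (y 0))) (M i) (a i) y - Minkowski.bilin)) x (E4.basisVector 0)‖ₑ) atTop (𝓝 0)) → (∀ ρ : ℝ → ℝ, Tendsto ρ atTop atTop → ∀ δ : ℝ, 0 < δ → δ < 1 → ∃ (T : ℝ) (ζ : ℝ → ℝ), Tendsto ζ atTop (𝓝 0) ∧ ∀ (t : ℝ) (c : E3) (R : ℝ) (A : Finset (Fin N)), T ≤ t → ρ t ≤ δ * R → ‖c‖ + R ≤ (κ + κ ^ 2) / 2 * t → (∀ j, ‖ξ j t - c‖ ≤ (1 - δ) * R ∨ (1 + δ) * R ≤ ‖ξ j t - c‖) → (∀ j, j ∈ A ↔ ‖ξ j t - c‖ ≤ (1 - δ) * R) → |(LandauLifshitz.quasiLocalMomentum (fun x : E4 ↦ (Minkowski.bilin + ∑ i, (boostedKerrBilin (Λ i (x 0)) (E4.ofTimeSpace (x 0) (ξ i (x 0))) (M i) (a i) x - Minkowski.bilin)) + 𝒟.toSpacetime.deviationExtend (⟨U, fun x ↦ Minkowski.bilin + ∑ i, (boostedKerrBilin (Λ i (x 0)) (E4.ofTimeSpace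 (x 0) (ξ i (x 0))) (M i) (a i) x - Minkowski.bilin), fun x ↦ x 0, E4.spatialNorm⟩ : ModelBackground) Φ x)) t c R 0 - ∑ j ∈ A, M j * (√(1 - ‖(((((Λ j t : lorentzGroup) : E4 ≃L[ℝ] E4) (E4.basisVector 0)) 0)⁻¹ • E4.spatial (((Λ j t : lorentzGroup) : E4 ≃L[ℝ] E4) (E4.basisVector 0)))‖ ^ 2))⁻¹| ≤ ζ t ∧ ∀ k : Fin 3, |(LandauLifshitz.quasiLocalMomentum (fun x : E4 ↦ (Minkowski.bilin + ∑ i, (boostedKerrBilin (Λ i (x 0)) (E4.ofTimeSpace (x 0) (ξ i (x 0))) (M i) (a i) x - Minkowski.bilin)) + 𝒟.toSpacetime.deviationExtend (⟨U, fun x ↦ Minkowski.bilin + ∑ i, (boostedKerrBilin (Λ i (x 0)) (E4.ofTimeSpace (x 0) (ξ i (x 0))) (M i) (a i) x - Minkowski.bilin), fun x ↦ x 0, E4.spatialNorm⟩ : ModelBackground) Φ x)) t c R k.succ - ∑ j ∈ A, M j * (√(1 - ‖(((((Λ j t : lorentzGroup) : E4 ≃L[ℝ] E4) (E4.basisVector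 0)) 0)⁻¹ • E4.spatial (((Λ j t : lorentzGroup) : E4 ≃L[ℝ] E4) (E4.basisVector 0)))‖ ^ 2))⁻¹ * (((((Λ j t : lorentzGroup) : E4 ≃L[ℝ] E4) (E4.basisVector 0)) 0)⁻¹ • E4.spatial (((Λ j t : lorentzGroup) : E4 ≃L[ℝ] E4) (E4.basisVector 0))) k| ≤ ζ t) := by
  intro hPTB X _ _ _ _ _ _ D hD 𝒟 h𝒟 N M a rin Λ ξ γ κ τ₀ U Φ O hL hN hS hQ ρ hρ δ hδ0 hδ1
  classical
  obtain ⟨Cp, hCp0, hPTB⟩ := hPTB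
  obtain ⟨hsub, hγ, hsmooth, hsep, hκ, hU, hrest⟩ := hL
  obtain ⟨hΦ, -, -, -, hWt, -, -⟩ := hrest
  set Gb : E4 → E4 →L[ℝ] E4 →L[ℝ] ℝ := fun x ↦ Minkowski.bilin + ∑ i, (boostedKerrBilin (Λ i (x 0)) (E4.ofTimeSpace (x 0) (ξ i (x 0))) (M i) (a i) x - Minkowski.bilin) with hGbdef
  set B : ModelBackground := ⟨U, Gb, fun x ↦ x 0, E4.spatialNorm⟩ with hBdef
  set dev : E4 → E4 →L[ℝ] E4 →L[ℝ] ℝ := 𝒟.toSpacetime.deviationExtend B Φ with hdevdef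
  set lab : E4 → E4 →L[ℝ] E4 →L[ℝ] ℝ := fun x ↦ Gb x + dev x with hlabdef
  -- (0) basic facts
  have hrin : ∀ i, 0 ≤ rin i := fun i ↦ (hsub i).1.rMinus_nonneg.trans (hsub i).2.1.le
  have hΛ : ∀ i, ContDiff ℝ ∞ (fun t ↦ ((Λ i t : E4 ≃L[ℝ] E4) : E4 →L[ℝ] E4)) := fun i ↦ (hsmooth i).2
  have hξ : ∀ i, ContDiff ℝ ∞ (ξ i) := fun i ↦ (hsmooth i).1
  have hΛ1 : ∀ i, ContDiff ℝ 1 (fun t ↦ ((Λ i t : E4 ≃L[ℝ] E4) : E4 →L[ℝ] E4)) := fun i ↦ (hΛ i).of_le (mod_cast le_top)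
  have hξ1 : ∀ i, ContDiff ℝ 1 (ξ i) := fun i ↦ (hξ i).of_le (mod_cast le_top)
  have hRic : ∀ [𝒟.toSpacetime.metric.toPseudoRiemannianMetric.HasLeviCivita],
      𝒟.toSpacetime.metric.toPseudoRiemannianMetric.IsRicciFlat := 𝒟.isRicciFlat
  obtain ⟨hκ0, hκ1, -⟩ := hκ
  haveI : Nonempty (Fin N) := ⟨⟨0, hN⟩⟩
  have hγ1 : 1 ≤ γ := (one_le_abs_lorentz_apply_zero (Λ ⟨0, hN⟩ 0)).trans (hγ ⟨0, hN⟩ 0)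
  obtain ⟨G, hG⟩ : ∃ G : ℝ, G = 1 + 3 * γ := ⟨_, rfl⟩
  have hG1 : 1 ≤ G := by rw [hG]; linarith
  have hG0 : 0 ≤ G := zero_le_one.trans hG1
  -- (1) constants of the window estimate
  obtain ⟨Cs, Bv, Bw, Bd₀, Bd₁, Cf, Rf, hCs, hBv, hBw, hBd₀, hBd₁, hCRf, hWIN⟩ := window_estimate hN M a
  obtain ⟨Cfm, hCfm⟩ : ∃ Cfm : ℝ, Cfm = ∑ i, Cf i := ⟨_, rfl⟩
  obtain ⟨Mm, hMm⟩ : ∃ Mm : ℝ, Mm = ∑ i, |M i| := ⟨_, rfl⟩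
  have hCfm0 : 0 ≤ Cfm := by rw [hCfm]; exact Finset.sum_nonneg fun i _ ↦ (hCRf i).1
  have hMm0 : 0 ≤ Mm := by rw [hMm]; exact Finset.sum_nonneg fun i _ ↦ abs_nonneg _
  have hCf_le : ∀ i, Cf i ≤ Cfm := fun i ↦ by
    rw [hCfm]; exact Finset.single_le_sum (fun j _ ↦ (hCRf j).1) (Finset.mem_univ i)
  have hM_le : ∀ i, |M i| ≤ Mm := fun i ↦ by
    rw [hMm]; exact Finset.single_le_sum (fun j _ ↦ abs_nonneg (M j)) (Finset.mem_univ i)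
  -- (2) the slaving rates
  obtain ⟨rate, hrate⟩ : ∃ rate : ℝ → ℝ, rate = fun t ↦ ∑ i,
      (‖deriv (fun s ↦ (Λ i s : E4 ≃L[ℝ] E4) (E4.basisVector 0)) t‖ +
        if a i = 0 then 0 else ‖deriv (fun s ↦ (Λ i s : E4 ≃L[ℝ] E4) (E4.basisVector 3)) t‖) := ⟨_, rfl⟩
  have hrate0 : ∀ t, 0 ≤ rate t := fun t ↦ by
    rw [hrate]; exact Finset.sum_nonneg fun i _ ↦ by split_ifs <;> positivity
  have hrate_lim : Tendsto rate atTop (𝓝 0) := by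
    have h := tendsto_finsetSum Finset.univ fun i _ ↦ tendsto_boostRate_zero (hS i).1 (hS i).2.2
    rw [Finset.sum_const_zero] at h
    rw [hrate]
    exact h
  obtain ⟨drift, hdrift⟩ : ∃ drift : ℝ → ℝ, drift = fun t ↦ ∑ i,
      ‖deriv (ξ i) t - (((Λ i t : E4 ≃L[ℝ] E4) (E4.basisVector 0)) 0)⁻¹ •
        E4.spatial ((Λ i t : E4 ≃L[ℝ] E4) (E4.basisVector 0))‖ := ⟨_, rfl⟩
  have hdrift0 : ∀ t, 0 ≤ drift t := fun t ↦ by rw [hdrift]; exact Finset.sum_nonneg fun i _ ↦ norm_nonneg _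
  have hdrift_lim : Tendsto drift atTop (𝓝 0) := by
    have h := tendsto_finsetSum Finset.univ fun i _ ↦ tendsto_drift_zero (Λ := Λ i) (ξ := ξ i) (hS i).2.1
    rw [Finset.sum_const_zero] at h
    rw [hdrift]
    exact h
  -- (3) the deviation size
  obtain ⟨F, hF⟩ : ∃ F : ℝ → ℝ≥0∞, F = fun t ↦ ⨆ x ∈ {x : U | x.1 0 = t ∧ E4.spatialNorm x.1 ≤ κ * t},
      ⨆ (m : ℕ) (_ : m ≤ 3), ENNReal.ofReal (1 + √(√((⨅ i, ‖E4.spatial x.1 - ξ i t‖) ^ 7))) *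
        ‖iteratedFDeriv ℝ m dev x.1‖ₑ := ⟨_, rfl⟩
  have hFlim : Tendsto F atTop (𝓝 0) := by rw [hF]; exact hWt
  obtain ⟨εf, hεf⟩ : ∃ εf : ℝ → ℝ, εf = fun t ↦ (min (F t) 1).toReal := ⟨_, rfl⟩
  have hεf0 : ∀ t, 0 ≤ εf t := fun t ↦ by rw [hεf]; exact ENNReal.toReal_nonneg
  have hεf_lim : Tendsto εf atTop (𝓝 0) := by rw [hεf]; exact tendsto_toReal_min_one hFlim
  have hdev_pt : ∀ t, F t < 1 → ∀ x : E4, x ∈ (U : Set E4) → x 0 = t → E4.spatialNorm x ≤ κ * t →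
      ∀ m : ℕ, m ≤ 3 → (1 + √(√((⨅ i, ‖E4.spatial x - ξ i t‖) ^ 7))) * ‖iteratedFDeriv ℝ m dev x‖ ≤ εf t := by
    intro t ht x hxU hx0 hxκ m hm
    rw [hF] at ht
    rw [hεf, hF]
    exact weightedClause_pointwise_fn ht hxU hx0 hxκ hm
  -- (4) the separation
  obtain ⟨Dm, hDm⟩ : ∃ Dm : ℝ → ℝ, Dm = fun t ↦
      ⨅ p : Fin N × Fin N, (‖ξ p.1 t - ξ p.2 t‖ + if p.1 = p.2 then (max t 1) ^ 2 else 0) := ⟨_, rfl⟩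
  obtain ⟨hDm_le, hDm_lim⟩ : (∀ t i j, i ≠ j → Dm t ≤ ‖ξ i t - ξ j t‖) ∧ Tendsto Dm atTop atTop := by
    rw [hDm]; exact pairSep_props hN ξ hsep
  -- (5) the radius of the small spheres
  obtain ⟨σ₁, hσ₁⟩ : ∃ σ₁ : ℝ → ℝ, σ₁ = fun t ↦ min (max t 1) ((rate t + (max t 1)⁻¹) ^ (-(1 / (2 * (1 : ℝ))))) :=
    ⟨_, rfl⟩
  obtain ⟨σ₂, hσ₂⟩ : ∃ σ₂ : ℝ → ℝ, σ₂ = fun t ↦ min (max t 1) ((εf t + (max t 1)⁻¹) ^ (-(1 / (2 * (1 / 4 : ℝ))))) :=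
    ⟨_, rfl⟩
  obtain ⟨ρ₀, hρ₀⟩ : ∃ ρ₀ : ℝ → ℝ, ρ₀ = fun t ↦ min (min (ρ t / 2) (Dm t ^ (1 / 2 : ℝ) / 4)) (min (σ₁ t) (σ₂ t)) :=
    ⟨_, rfl⟩
  have hρ₀_ρ : ∀ t, ρ₀ t ≤ ρ t / 2 := fun t ↦ by rw [hρ₀]; exact (min_le_left _ _).trans (min_le_left _ _)
  have hρ₀_D : ∀ t, ρ₀ t ≤ Dm t ^ (1 / 2 : ℝ) / 4 := fun t ↦ by
    rw [hρ₀]; exact (min_le_left _ _).trans (min_le_right _ _)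
  have hρ₀_σ₁ : ∀ t, ρ₀ t ≤ σ₁ t := fun t ↦ by rw [hρ₀]; exact (min_le_right _ _).trans (min_le_left _ _)
  have hρ₀_σ₂ : ∀ t, ρ₀ t ≤ σ₂ t := fun t ↦ by rw [hρ₀]; exact (min_le_right _ _).trans (min_le_right _ _)
  have hρ₀_lim : Tendsto ρ₀ atTop atTop := by
    have h1 : Tendsto (fun t ↦ ρ t / 2) atTop atTop := hρ.atTop_div_const (by norm_num)
    have h2 : Tendsto (fun t ↦ Dm t ^ (1 / 2 : ℝ) / 4) atTop atTop :=
      ((tendsto_rpow_atTop (by norm_num)).comp hDm_lim).atTop_div_const (by norm_num)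
    have h3 : Tendsto σ₁ atTop atTop := by rw [hσ₁]; exact tendsto_slowScale_atTop hrate_lim hrate0 one_pos
    have h4 : Tendsto σ₂ atTop atTop := by rw [hσ₂]; exact tendsto_slowScale_atTop hεf_lim hεf0 (by norm_num)
    rw [hρ₀]
    exact tendsto_min_atTop_atTop (tendsto_min_atTop_atTop h1 h2) (tendsto_min_atTop_atTop h3 h4)
  have hrate_ρ₀ : Tendsto (fun t ↦ rate t * ρ₀ t) atTop (𝓝 0) := by
    have h := tendsto_mul_slowScale_rpow hrate_lim hrate0 one_pos
    refine squeeze_zero' ?_ ?_ h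
    · filter_upwards [hρ₀_lim.eventually_ge_atTop 0] with t ht
      exact mul_nonneg (hrate0 t) ht
    · filter_upwards [hρ₀_lim.eventually_ge_atTop 0] with t ht
      have hσ : σ₁ t = min (max t 1) ((rate t + (max t 1)⁻¹) ^ (-(1 / (2 * (1 : ℝ))))) := by rw [hσ₁]
      rw [Real.rpow_one, ← hσ]
      exact mul_le_mul_of_nonneg_left (hρ₀_σ₁ t) (hrate0 t)
  have hεf_ρ₀ : Tendsto (fun t ↦ εf t * ρ₀ t ^ (1 / 4 : ℝ)) atTop (𝓝 0) := by
    have h := tendsto_mul_slowScale_rpow hεf_lim hεf0 (by norm_num : (0 : ℝ) < 1 / 4)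
    refine squeeze_zero' ?_ ?_ h
    · filter_upwards [hρ₀_lim.eventually_ge_atTop 0] with t ht
      exact mul_nonneg (hεf0 t) (Real.rpow_nonneg ht _)
    · filter_upwards [hρ₀_lim.eventually_ge_atTop 0] with t ht
      have hσ : σ₂ t = min (max t 1) ((εf t + (max t 1)⁻¹) ^ (-(1 / (2 * (1 / 4 : ℝ))))) := by rw [hσ₂]
      rw [← hσ]
      exact mul_le_mul_of_nonneg_left (Real.rpow_le_rpow ht (hρ₀_σ₂ t) (by norm_num)) (hεf0 t)
  -- (6) the far-field control of the lab metric beyond `ρ₀`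
  obtain ⟨Tsc, K, hK0, hsc⟩ := ChargeModel.sphereConditions 𝒟.toSpacetime M a rin Λ ξ γ κ τ₀ U Φ hrin hγ hΛ hξ
    hU hΦ hWt hQ ρ₀ hρ₀_lim
  obtain ⟨hWopen, hWsmooth, hWsymm, hWric⟩ := ChargeModel.labRegion_props 𝒟.toSpacetime B Φ hΦ hRic
  -- (7) the error function
  obtain ⟨ζ, hζ⟩ : ∃ ζ : ℝ → ℝ, ζ = fun t ↦ Cp * K ^ 2 * N * (8 * Real.pi * ρ₀ t ^ (-(1 / 2) : ℝ)) +
      N * (Cs * (4 * G ^ 3 * Cfm * N * (Dm t)⁻¹ +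
        N * (Mm * G ^ 2 * ((Bd₁ * G + 2 * Bd₀) * (4 * G) * (rate t * ρ₀ t) + Bd₁ * G * drift t)) +
        εf t * ρ₀ t ^ (1 / 4 : ℝ) + (2 * G ^ 2 * Mm * Bv * (Dm t)⁻¹ + εf t) * (G ^ 3 * Cfm))) := ⟨_, rfl⟩
  have hζ_lim : Tendsto ζ atTop (𝓝 0) := by
    have hD0 : Tendsto (fun t ↦ (Dm t)⁻¹) atTop (𝓝 0) := tendsto_inv_atTop_zero.comp hDm_lim
    have hρhalf : Tendsto (fun t ↦ ρ₀ t ^ (-(1 / 2) : ℝ)) atTop (𝓝 0) :=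
      (tendsto_rpow_neg_atTop (by norm_num : (0 : ℝ) < 1 / 2)).comp hρ₀_lim
    have hA : Tendsto (fun t ↦ Cp * K ^ 2 * N * (8 * Real.pi * ρ₀ t ^ (-(1 / 2) : ℝ))) atTop (𝓝 0) := by
      simpa only [mul_zero] using (hρhalf.const_mul (8 * Real.pi)).const_mul (Cp * K ^ 2 * N)
    have hB1 : Tendsto (fun t ↦ 4 * G ^ 3 * Cfm * N * (Dm t)⁻¹) atTop (𝓝 0) := by
      simpa only [mul_zero] using hD0.const_mul (4 * G ^ 3 * Cfm * N)
    have hB2 : Tendsto (fun t ↦ N * (Mm * G ^ 2 * ((Bd₁ * G + 2 * Bd₀) * (4 * G) * (rate t * ρ₀ t) +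
        Bd₁ * G * drift t))) atTop (𝓝 0) := by
      simpa only [mul_zero, add_zero] using (((hrate_ρ₀.const_mul ((Bd₁ * G + 2 * Bd₀) * (4 * G))).add
        (hdrift_lim.const_mul (Bd₁ * G))).const_mul (Mm * G ^ 2)).const_mul (N : ℝ)
    have hB4 : Tendsto (fun t ↦ (2 * G ^ 2 * Mm * Bv * (Dm t)⁻¹ + εf t) * (G ^ 3 * Cfm)) atTop (𝓝 0) := by
      simpa only [mul_zero, zero_add, zero_mul] using
        ((hD0.const_mul (2 * G ^ 2 * Mm * Bv)).add hεf_lim).mul_const (G ^ 3 * Cfm)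
    have hB : Tendsto (fun t ↦ N * (Cs * (4 * G ^ 3 * Cfm * N * (Dm t)⁻¹ +
        N * (Mm * G ^ 2 * ((Bd₁ * G + 2 * Bd₀) * (4 * G) * (rate t * ρ₀ t) + Bd₁ * G * drift t)) +
        εf t * ρ₀ t ^ (1 / 4 : ℝ) + (2 * G ^ 2 * Mm * Bv * (Dm t)⁻¹ + εf t) * (G ^ 3 * Cfm)))) atTop (𝓝 0) := by
      simpa only [mul_zero, add_zero] using ((((hB1.add hB2).add hεf_ρ₀).add hB4).const_mul Cs).const_mul (N : ℝ)
    rw [hζ]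
    simpa only [add_zero] using hA.add hB
  -- (8) thresholds and the starting time
  obtain ⟨Rthr, hRthr⟩ : ∃ Rthr : ℝ, Rthr = 4 + ∑ i, (Rf i + |a i| + max 1 (2 * |a i|)) + 2 * G ^ 2 * Mm * Bw := ⟨_, rfl⟩
  have hRthr_i : ∀ i, Rf i + |a i| ≤ Rthr ∧ max 1 (2 * |a i|) ≤ Rthr ∧ |a i| < Rthr := fun i ↦ by
    have hs : Rf i + |a i| + max 1 (2 * |a i|) ≤ ∑ j, (Rf j + |a j| + max 1 (2 * |a j|)) :=
      Finset.single_le_sum (f := fun j ↦ Rf j + |a j| + max 1 (2 * |a j|))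
        (fun j _ ↦ by have := (hCRf j).2; positivity) (Finset.mem_univ i)
    have h1 : 0 ≤ max 1 (2 * |a i|) := by positivity
    have h2 : 0 < Rf i := (hCRf i).2
    have h3 : 0 ≤ 2 * G ^ 2 * Mm * Bw := by positivity
    rw [hRthr]
    exact ⟨by linarith, by linarith [abs_nonneg (a i)], by linarith [abs_nonneg (a i)]⟩
  have hRthr4 : 4 ≤ Rthr ∧ 2 * G ^ 2 * Mm * Bw ≤ Rthr := by
    rw [hRthr]
    have : 0 ≤ ∑ j, (Rf j + |a j| + max 1 (2 * |a j|)) :=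
      Finset.sum_nonneg fun j _ ↦ by have := (hCRf j).2; positivity
    have h3 : 0 ≤ 2 * G ^ 2 * Mm * Bw := by positivity
    exact ⟨by linarith, by linarith⟩
  have hev : ∀ᶠ t in atTop, Tsc ≤ t ∧ F t < 1 ∧ Rthr ≤ ρ₀ t ∧ 16 ≤ Dm t ∧ 1 ≤ t := by
    refine (eventually_ge_atTop Tsc).and ((?_ : ∀ᶠ t in atTop, F t < 1).and
      ((hρ₀_lim.eventually_ge_atTop Rthr).and ((hDm_lim.eventually_ge_atTop 16).and (eventually_ge_atTop 1))))
    exact (ENNReal.tendsto_nhds_zero.1 hFlim) (1 / 2) (by norm_num) |>.mono fun t ht ↦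
      ht.trans_lt (by norm_num)
  obtain ⟨T, hT⟩ := eventually_atTop.1 hev
  refine ⟨T, ζ, hζ_lim, ?_⟩
  intro t c R A hTt hρR hcR hclean hA
  obtain ⟨hT1, hT2, hT3, hT4, hT5⟩ := hT t hTt
  -- (9) the window at time `t`
  have hρ₀4 : 4 ≤ ρ₀ t := hRthr4.1.trans hT3
  have hρ₀0 : 0 < ρ₀ t := by linarith
  have hρt : 2 * ρ₀ t ≤ δ * R := by linarith [hρ₀_ρ t]
  have ht0 : 0 ≤ t := zero_le_one.trans hT5
  have hDm1 : 1 ≤ Dm t := le_trans (by norm_num) hT4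
  have hDmρ : 4 * ρ₀ t ≤ Dm t := by
    have h1 := hρ₀_D t
    have h2 : Dm t ^ (1 / 2 : ℝ) ≤ Dm t := by
      conv_rhs => rw [← Real.rpow_one (Dm t)]
      exact Real.rpow_le_rpow_of_exponent_le hDm1 (by norm_num)
    linarith
  have hDm0 : 0 < Dm t := by linarith
  have hρ₀sqD : ρ₀ t ^ 2 ≤ Dm t / 16 := by
    have h1 := hρ₀_D t
    have h2 : (Dm t ^ (1 / 2 : ℝ)) ^ 2 = Dm t := by
      rw [← Real.rpow_natCast _ 2, ← Real.rpow_mul hDm0.le]; norm_num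
    have h3 : 0 ≤ Dm t ^ (1 / 2 : ℝ) / 4 := by positivity
    nlinarith [pow_le_pow_left₀ hρ₀0.le h1 2]
  have hcone : ∀ y : E3, dist y c ≤ R → ‖y‖ ≤ κ * t := fun y hy ↦
    norm_le_cone_of_window hy hcR hκ0.le hκ1.le ht0
  -- sphere conditions and weighted bounds at the slice points of the perforated window ball
  have hpt : ∀ y : E3, dist y c ≤ R → (∀ i, ρ₀ t ≤ ‖y - ξ i t‖) →
      E4.ofTimeSpace t y ∈ {x : E4 | x ∈ (B.domain : Set E4) ∧
        ‖(B.bilin x + 𝒟.toSpacetime.deviationExtend B Φ x) - Minkowski.bilin‖ < 1} ∧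
      ‖lab (E4.ofTimeSpace t y) - Minkowski.bilin‖ ≤ 1 / 2 ∧
      ∀ v : E4, ‖fderiv ℝ lab (E4.ofTimeSpace t y) v‖ ≤ K * ((⨅ i, ‖y - ξ i t‖) ^ (7 / 4 : ℝ))⁻¹ * ‖v‖ :=
    fun y hy hfar' ↦ hsc t y hT1 (hcone y hy) (le_ciInf hfar')
  have hdevfun : (fun x : E4 ↦ lab x - Gb x) = dev := by
    funext x; simp only [hlabdef, add_sub_cancel_left]
  have hdevb : ∀ y : E3, dist y c ≤ R → (∀ i, ρ₀ t ≤ ‖y - ξ i t‖) → ∀ m : ℕ, m ≤ 3 →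
      (1 + √(√((⨅ i, ‖y - ξ i t‖) ^ 7))) * ‖iteratedFDeriv ℝ m (fun x : E4 ↦ lab x - Gb x) (E4.ofTimeSpace t y)‖ ≤
        εf t := by
    intro y hy hfar' m hm
    have h := hdev_pt t hT2 (E4.ofTimeSpace t y) (hpt y hy hfar').1.1 (E4.ofTimeSpace_apply_zero t y)
      (by rw [E4.spatialNorm_ofTimeSpace]; exact hcone y hy) m hm
    rwa [E4.spatial_ofTimeSpace, ← hdevfun] at h
  have key := hWIN Λ ξ γ Cp K lab _ t c R δ A (ρ₀ t) (Dm t) (εf t) hΛ1 hξ1 (fun i ↦ hγ i t) hCp0 hPTB hK0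
    hWopen hWsmooth hWsymm hWric hδ0 hclean hA hρ₀4 hρt (fun i ↦ ⟨(hRthr_i i).1.trans hT3,
      (hRthr_i i).2.1.trans hT3, (hRthr_i i).2.2.trans_le hT3⟩) (by rw [← hG, ← hMm]; exact hRthr4.2.trans hT3)
    hDmρ hρ₀sqD (hDm_le t) (hεf0 t) hpt hdevb
  have hrt : rate t = ∑ i, (‖deriv (fun s ↦ (Λ i s : E4 ≃L[ℝ] E4) (E4.basisVector 0)) t‖ +
      if a i = 0 then 0 else ‖deriv (fun s ↦ (Λ i s : E4 ≃L[ℝ] E4) (E4.basisVector 3)) t‖) := by rw [hrate]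
  have hdt : drift t = ∑ i, ‖deriv (ξ i) t - (((Λ i t : E4 ≃L[ℝ] E4) (E4.basisVector 0)) 0)⁻¹ •
      E4.spatial ((Λ i t : E4 ≃L[ℝ] E4) (E4.basisVector 0))‖ := by rw [hdrift]
  rw [← hG, ← hCfm, ← hMm, ← hrt, ← hdt] at key
  have key' : ∀ μ : Fin 4, |quasiLocalMomentum lab t c R μ -
      ∑ j ∈ A, quasiLocalMomentum (boostedKerrBilin (Λ j t) (E4.ofTimeSpace t (ξ j t)) (M j) (a j)) t (ξ j t) (ρ₀ t) μ| ≤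
      ζ t := fun μ ↦ by rw [hζ]; exact key μ
  -- (10) the exact frozen charges and the conclusion
  have hencl : ∀ j, ∀ y : E3, ‖E4.spatial (poincareInv (Λ j t) (E4.ofTimeSpace t (ξ j t)) (E4.ofTimeSpace t y))‖ ≤ |a j| →
      y ∈ ball (ξ j t) (ρ₀ t) := fun j y hy ↦
    mem_ball_of_spatialNorm_poincareInv_le (Λ j t) (ξ j t) ((hRthr_i j).2.2.trans_le hT3) y hy
  constructor
  · have h := key' 0
    rw [Finset.sum_congr rfl fun j _ ↦ quasiLocalMomentum_boostedKerr_energy (Λ j t) _ (M j) (a j) hρ₀0 (hencl j)] at h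
    exact h
  · intro k
    have h := key' k.succ
    rw [Finset.sum_congr rfl fun j _ ↦ quasiLocalMomentum_boostedKerr_momentum (Λ j t) _ (M j) (a j) hρ₀0 (hencl j) k]
      at h
    exact h

/-- Registered sub-goal form (stub `ll_rate_slowScale_tendsto` of the crux item): the boost-rate scale of
the identification, `rate · σ₁ → 0` for the slow scale `σ₁` of the rate (`tendsto_mul_slowScale_rpow` with
`p = 1`). [folklore] -/
theorem _root_.Summit.FinalStateConjecture.FinalStateConjecture.Theorems.ll_rate_slowScale_tendsto : ∀ {u : ℝ → ℝ}, Filter.Tendsto u Filter.atTop (nhds 0) → (∀ t, 0 ≤ u t) → Filter.Tendsto (fun t ↦ u t * (min (max t 1) ((u t + (max t 1)⁻¹) ^ (-(1 / (2 * (1 : ℝ)))))) ^ (1 : ℝ)) Filter.atTop (nhds 0) :=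
  fun hu hu0 ↦ tendsto_mul_slowScale_rpow hu hu0 one_pos

end SublinearIsFree.ChargeModel

end Summit.FinalStateConjecture.FinalStateConjecture.Theorems

end
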